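import Summits.CriticalPhenomena.PercolationContinuityZ3.Theorems.SahiMasterFamilyStructFaces
import Summits.CriticalPhenomena.PercolationContinuityZ3.Theorems.SahiMasterFamilyL3Reduce

/-!
# The glued frame field of a family whose 1-faces are structured

Unit `prim-master-conj` (crux anchor stmt-CriticalPhenomena-4575), gen 11; memo HOME/prim-master-conj/TIGHTNESS-III.md §1.2–§1.5.

For a family `U : κ → Set (Set ι)` of increasing events and a finite index set `W`, suppose every CONTRACTION face
`k ↦ (U k)^{h ← true}` (`h : ι`) is structured (`Structured`, gen 6).  The canonical frames (`cframe`) of these faces agree on the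
common double faces (`cframe_secAt`, gen 9), so they GLUE to one family of increasing events on `ι`, the glued frame field
`gframe U W w := {ω | ∀ h, insert h ω ∈ cframe (k ↦ (U k)^{h←true}) W w}`:
* `isUpperSet_gframe`, `subset_gframe` (`U w ⊆ gframe U W w`);
* `cframe_faceT_ignores` — the canonical frame of the `h`-face ignores `h`;
* `secAt_faceT_cframe_comm` — the double-face consistency `(cframe of the h-face)^{h'←true} = (cframe of the h'-face)^{h←true}`;
* **`mem_gframe_iff_of_mem`** — for `h ∈ ω`: `ω ∈ gframe U W w ↔ ω ∈ cframe (h-face) W w`;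
* **`secAt_true_gframe`** — every contraction of the glued frame is the canonical frame of the corresponding face;
* `gann` (the glued annihilator `gframe ∖ U`) and `secAt_true_gann`;
* **`vertex_lemma`** (TIGHTNESS-III 1.5): for an increasing event `A` and a non-empty set `N ⊆ A` of configurations which is
  down-closed inside `A` and all of whose members contain the set `V` of "vertices inside the support" (`f ∈ esupp A` with
  `univ ∖ {f} ∈ A`), `V` is empty.
These are the order-free foundations of THEOREM LG4 (TIGHTNESS-III §2: the local-to-global step at order four); the
hypothesis of that theorem is the support-disjointness of `gframe`.  Pure combinatorics; axioms standard. [this work]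
-/

noncomputable section

open scoped Classical

namespace Summit.CriticalPhenomena.PercolationContinuityZ3.Theorems

namespace GluedFrames

open Finset Function
open Literature.Probability.LatticeModels.Kahn2022 (Affects)

variable {ι : Type*} [Fintype ι] {κ : Type*} (U : κ → Set (Set ι)) (W : Finset κ)

/-! ### Faces -/

/-- The contraction face at `h`: `k ↦ (U k)^{h ← true}`. [this work] -/
def faceT (h : ι) : κ → Set (Set ι) := fun k => secAt h true (U k)

omit [Fintype ι] in
/-- Unfolding `faceT`. [this work] -/
@[simp] theorem faceT_apply (h : ι) (k : κ) : faceT U h k = secAt h true (U k) := rfl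

omit [Fintype ι] in
/-- Faces of increasing events are increasing. [folklore] -/
theorem isUpperSet_faceT (hU : ∀ k, IsUpperSet (U k)) (h : ι) : ∀ k, IsUpperSet (faceT U h k) :=
  fun k => isUpperSet_secAt h true (hU k)

omit [Fintype ι] in
/-- Contraction faces of non-empty increasing events are non-empty. [folklore] -/
theorem faceT_nonempty (hU : ∀ k, IsUpperSet (U k)) (hne : ∀ k, (U k).Nonempty) (h : ι) :
    ∀ k, (faceT U h k).Nonempty := by
  intro k
  obtain ⟨ω, hω⟩ := hne k
  exact ⟨ω, subset_secAt_true (hU k) h hω⟩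

omit [Fintype ι] in
/-- Contracting twice at the same coordinate is contracting once. [folklore] -/
theorem secAt_true_secAt_true (h : ι) (A : Set (Set ι)) : secAt h true (secAt h true A) = secAt h true A := by
  ext ω
  rw [mem_secAt, mem_secAt, mem_secAt]
  simp only [forceAt, cond_true, Set.insert_eq_of_mem (Set.mem_insert h ω)]

omit [Fintype ι] in
/-- Double contraction faces, same coordinate. [folklore] -/
theorem secAt_true_faceT_self (h : ι) : (fun k => secAt h true (faceT U h k)) = faceT U h := by
  funext k; exact secAt_true_secAt_true h (U k)

omit [Fintype ι] in
/-- Double contraction faces commute. [folklore] -/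
theorem secAt_true_faceT_comm {h h' : ι} (hh : h ≠ h') :
    (fun k => secAt h' true (faceT U h k)) = fun k => secAt h true (faceT U h' k) := by
  funext k
  simp only [faceT_apply]
  exact secAt_comm (Ne.symm hh) true true

omit [Fintype ι] in
/-- Non-emptiness of the double contraction faces. [folklore] -/
theorem secAt_true_faceT_nonempty (hU : ∀ k, IsUpperSet (U k)) (hne : ∀ k, (U k).Nonempty) (h h' : ι) :
    ∀ k, (secAt h' true (faceT U h k)).Nonempty :=
  faceT_nonempty (faceT U h) (isUpperSet_faceT U hU h) (faceT_nonempty U hU hne h) h'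

/-! ### Canonical frames of the faces -/

/-- **The canonical frame of the `h`-face ignores `h`.** [this work] -/
theorem cframe_faceT_ignores (hU : ∀ k, IsUpperSet (U k)) (hne : ∀ k, (U k).Nonempty) {h : ι}
    (hS : Structured (faceT U h) W) {w : κ} (hw : w ∈ W) :
    secAt h true (cframe (faceT U h) W w) = cframe (faceT U h) W w := by
  have e := cframe_secAt (faceT U h) h true (isUpperSet_faceT U hU h) (secAt_true_faceT_nonempty U hU hne h h) hS hw
  rw [secAt_true_faceT_self] at e
  exact e.symm

/-- Membership in the canonical frame of the `h`-face does not depend on `h`. [this work] -/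
theorem insert_mem_cframe_faceT_iff (hU : ∀ k, IsUpperSet (U k)) (hne : ∀ k, (U k).Nonempty) {h : ι}
    (hS : Structured (faceT U h) W) {w : κ} (hw : w ∈ W) (ω : Set ι) :
    insert h ω ∈ cframe (faceT U h) W w ↔ ω ∈ cframe (faceT U h) W w := by
  conv_rhs => rw [← cframe_faceT_ignores U W hU hne hS hw]
  rw [mem_secAt]; simp only [forceAt, cond_true]

/-- **Double-face consistency**: the `h'`-contraction of the canonical frame of the `h`-face is the `h`-contraction of the canonical
frame of the `h'`-face (both are the canonical frame of the common double face, by `cframe_secAt`). [this work] -/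
theorem secAt_faceT_cframe_comm (hU : ∀ k, IsUpperSet (U k)) (hne : ∀ k, (U k).Nonempty) {h h' : ι} (hh : h ≠ h')
    (hS : Structured (faceT U h) W) (hS' : Structured (faceT U h') W) {w : κ} (hw : w ∈ W) :
    secAt h' true (cframe (faceT U h) W w) = secAt h true (cframe (faceT U h') W w) := by
  rw [← cframe_secAt (faceT U h) h' true (isUpperSet_faceT U hU h) (secAt_true_faceT_nonempty U hU hne h h') hS hw,
    ← cframe_secAt (faceT U h') h true (isUpperSet_faceT U hU h') (secAt_true_faceT_nonempty U hU hne h' h) hS' hw,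
    secAt_true_faceT_comm U hh]

/-- **Consistency of two face frames**: a configuration containing both `h` and `h'` lies in the canonical frame of the `h`-face iff
it lies in the canonical frame of the `h'`-face. [this work] -/
theorem mem_cframe_faceT_iff_of_mem_of_mem (hU : ∀ k, IsUpperSet (U k)) (hne : ∀ k, (U k).Nonempty) {h h' : ι}
    (hS : Structured (faceT U h) W) (hS' : Structured (faceT U h') W) {w : κ} (hw : w ∈ W) {ω : Set ι} (hω : h ∈ ω)
    (hω' : h' ∈ ω) : ω ∈ cframe (faceT U h) W w ↔ ω ∈ cframe (faceT U h') W w := by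
  by_cases hh : h = h'
  · subst hh; exact Iff.rfl
  · have e := secAt_faceT_cframe_comm U W hU hne hh hS hS' hw
    have h1 : ω ∈ secAt h' true (cframe (faceT U h) W w) ↔ ω ∈ secAt h true (cframe (faceT U h') W w) := by rw [e]
    rw [mem_secAt, mem_secAt] at h1
    simp only [forceAt, cond_true, Set.insert_eq_of_mem hω, Set.insert_eq_of_mem hω'] at h1
    exact h1

/-! ### The glued frame field -/

/-- **The glued frame** of the member `w`: the configurations all of whose one-point enlargements `insert h ω` lie in the canonical
frame of `w` in the `h`-face. [this work] -/
def gframe (w : κ) : Set (Set ι) := {ω | ∀ h : ι, insert h ω ∈ cframe (faceT U h) W w}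

/-- Membership in the glued frame. [this work] -/
theorem mem_gframe {w : κ} {ω : Set ι} : ω ∈ gframe U W w ↔ ∀ h : ι, insert h ω ∈ cframe (faceT U h) W w := Iff.rfl

/-- The glued frame is increasing. [this work] -/
theorem isUpperSet_gframe (hU : ∀ k, IsUpperSet (U k)) (w : κ) : IsUpperSet (gframe U W w) := by
  intro ω ω' hle hω h
  exact isUpperSet_cframe (faceT U h) (isUpperSet_faceT U hU h) W w (Set.insert_subset_insert hle) (hω h)

/-- **A member lies in its glued frame.** [this work] -/
theorem subset_gframe (hU : ∀ k, IsUpperSet (U k)) (w : κ) : U w ⊆ gframe U W w := by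
  intro ω hω h
  refine subset_cframe (faceT U h) (isUpperSet_faceT U hU h) W w ?_
  rw [faceT_apply, mem_secAt]
  simp only [forceAt, cond_true, Set.insert_eq_of_mem (Set.mem_insert h ω)]
  exact hU w (Set.subset_insert h ω) hω

/-- **Glued frame vs. face frame**: for `h ∈ ω`, `ω` lies in the glued frame iff it lies in the canonical frame of the `h`-face
(all contraction faces structured). [this work] -/
theorem mem_gframe_iff_of_mem (hU : ∀ k, IsUpperSet (U k)) (hne : ∀ k, (U k).Nonempty) (hS : ∀ h, Structured (faceT U h) W)
    {w : κ} (hw : w ∈ W) {ω : Set ι} {h : ι} (hω : h ∈ ω) : ω ∈ gframe U W w ↔ ω ∈ cframe (faceT U h) W w := by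
  constructor
  · intro hg
    have := hg h
    rwa [Set.insert_eq_of_mem hω] at this
  · intro hc h'
    have hup : insert h' ω ∈ cframe (faceT U h) W w :=
      isUpperSet_cframe (faceT U h) (isUpperSet_faceT U hU h) W w (Set.subset_insert h' ω) hc
    exact (mem_cframe_faceT_iff_of_mem_of_mem U W hU hne (hS h) (hS h') hw (Set.mem_insert_of_mem h' hω)
      (Set.mem_insert h' ω)).1 hup

/-- **Every contraction of the glued frame is the canonical frame of that face.** [this work] -/
theorem secAt_true_gframe (hU : ∀ k, IsUpperSet (U k)) (hne : ∀ k, (U k).Nonempty) (hS : ∀ h, Structured (faceT U h) W)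
    {w : κ} (hw : w ∈ W) (h : ι) : secAt h true (gframe U W w) = cframe (faceT U h) W w := by
  ext ω
  rw [mem_secAt]
  simp only [forceAt, cond_true]
  rw [mem_gframe_iff_of_mem U W hU hne hS hw (Set.mem_insert h ω)]
  exact insert_mem_cframe_faceT_iff U W hU hne (hS h) hw ω

/-- A non-empty configuration lies in the glued frame iff it lies in the canonical frame of the `h`-face for SOME `h` in it. [this work] -/
theorem mem_gframe_iff_exists (hU : ∀ k, IsUpperSet (U k)) (hne : ∀ k, (U k).Nonempty) (hS : ∀ h, Structured (faceT U h) W)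
    {w : κ} (hw : w ∈ W) {ω : Set ι} (hω : ω.Nonempty) :
    ω ∈ gframe U W w ↔ ∃ h ∈ ω, ω ∈ cframe (faceT U h) W w := by
  obtain ⟨h₀, hh₀⟩ := hω
  constructor
  · intro hg; exact ⟨h₀, hh₀, (mem_gframe_iff_of_mem U W hU hne hS hw hh₀).1 hg⟩
  · rintro ⟨h, hh, hc⟩; exact (mem_gframe_iff_of_mem U W hU hne hS hw hh).2 hc

/-- The empty configuration lies in the glued frame iff every singleton does, iff the glued frame is everything. [this work] -/
theorem empty_mem_gframe_iff (hU : ∀ k, IsUpperSet (U k)) (w : κ) :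
    (∅ : Set ι) ∈ gframe U W w ↔ gframe U W w = Set.univ := by
  constructor
  · intro h
    exact Set.eq_univ_of_forall fun ω => isUpperSet_gframe U W hU w (Set.empty_subset ω) h
  · intro h; rw [h]; exact Set.mem_univ _

/-! ### The glued annihilator -/

/-- **The glued annihilator** of `w`: glued frame minus member. [this work] -/
def gann (w : κ) : Set (Set ι) := gframe U W w \ U w

/-- Membership in the glued annihilator. [this work] -/
theorem mem_gann {w : κ} {ω : Set ι} : ω ∈ gann U W w ↔ ω ∈ gframe U W w ∧ ω ∉ U w := Iff.rfl

omit [Fintype ι] in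
/-- Sections commute with set difference. [folklore] -/
theorem secAt_diff (e : ι) (b : Bool) (A B : Set (Set ι)) : secAt e b (A \ B) = secAt e b A \ secAt e b B := by
  ext ω; simp only [mem_secAt, Set.mem_sdiff]

/-- **Every contraction of the glued annihilator is the canonical annihilator of that face.** [this work] -/
theorem secAt_true_gann (hU : ∀ k, IsUpperSet (U k)) (hne : ∀ k, (U k).Nonempty) (hS : ∀ h, Structured (faceT U h) W)
    {w : κ} (hw : w ∈ W) (h : ι) : secAt h true (gann U W w) = cframe (faceT U h) W w \ faceT U h w := by
  rw [gann, secAt_diff, secAt_true_gframe U W hU hne hS hw h, faceT_apply]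

/-- **The glued annihilator is down-closed inside the glued frame.** [this work] -/
theorem mem_gann_of_subset (hU : ∀ k, IsUpperSet (U k)) {w : κ} {χ χ' : Set ι} (hχ : χ ∈ gann U W w) (hle : χ' ⊆ χ)
    (hχ' : χ' ∈ gframe U W w) : χ' ∈ gann U W w :=
  ⟨hχ', fun h => hχ.2 (hU w hle h)⟩

/-- A member is PURE (equal to its glued frame) iff its glued annihilator is empty. [this work] -/
theorem gann_eq_empty_iff (hU : ∀ k, IsUpperSet (U k)) (w : κ) : gann U W w = ∅ ↔ gframe U W w = U w := by
  rw [gann, Set.sdiff_eq_empty]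
  exact ⟨fun h => Set.Subset.antisymm h (subset_gframe U W hU w), fun h => h.le⟩

/-! ### The vertex lemma -/

/-- The VERTICES of an increasing event inside its support: the essential coordinates `f` with `univ ∖ {f} ∈ A`
(TIGHTNESS-III 1.4: the vertices of the cap complex lying in the block of `A`). [this work] -/
def verts (A : Set (Set ι)) : Finset ι := (esupp A).filter fun f => Set.univ \ {f} ∈ A

/-- Membership in `verts`. [this work] -/
theorem mem_verts {A : Set (Set ι)} {f : ι} : f ∈ verts A ↔ f ∈ esupp A ∧ Set.univ \ {f} ∈ A := by
  simp [verts]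

/-- A configuration missing a NON-vertex of the support is outside the event. [this work] -/
theorem not_mem_of_not_mem_of_not_vert {A : Set (Set ι)} (hA : IsUpperSet A) {σ : Set ι} {c : ι} (hc : c ∈ esupp A)
    (hcv : c ∉ verts A) (hcσ : c ∉ σ) : σ ∉ A := by
  intro hσ
  have hsub : σ ⊆ Set.univ \ {c} := fun x hx => ⟨Set.mem_univ x, fun hxc => hcσ (hxc ▸ hx)⟩
  exact hcv (mem_verts.2 ⟨hc, hA hsub hσ⟩)

/-- **Vertex lemma, pivotal form** (TIGHTNESS-III 1.5(i)): a configuration of `A` containing every vertex and at which every vertex is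
pivotal forces the vertex set to be empty. [this work] -/
theorem verts_eq_empty_of_pivotal {A : Set (Set ι)} (hA : IsUpperSet A) {σ : Set ι} (hσ : σ ∈ A) (hV : ↑(verts A) ⊆ σ)
    (hpiv : ∀ f ∈ verts A, σ \ {f} ∉ A) : verts A = ∅ := by
  by_contra hne
  obtain ⟨f, hf⟩ := Finset.nonempty_iff_ne_empty.2 hne
  by_cases hfull : ↑(esupp A) ⊆ σ
  · -- `σ ⊇ esupp A`: removing the vertex `f` leaves a configuration with the same trace as `univ ∖ {f}` on the support
    refine hpiv f hf ((mem_iff_of_inter_esupp_eq hA (ω' := Set.univ \ {f}) ?_).2 (mem_verts.1 hf).2)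
    ext x
    simp only [Set.mem_inter_iff, Set.mem_sdiff, Set.mem_singleton_iff, Set.mem_univ, true_and, mem_coe]
    constructor
    · rintro ⟨⟨-, hxf⟩, hx⟩; exact ⟨hxf, hx⟩
    · rintro ⟨hxf, hx⟩; exact ⟨⟨hfull hx, hxf⟩, hx⟩
  · -- some essential coordinate `c ∉ σ`; it is not a vertex, so `σ ∉ A`
    obtain ⟨c, hc, hcσ⟩ := Set.not_subset.1 hfull
    exact not_mem_of_not_mem_of_not_vert hA (mem_coe.1 hc) (fun hcv => hcσ (hV (mem_coe.2 hcv))) hcσ hσ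

/-- **Vertex lemma, down-closed form** (TIGHTNESS-III 1.5(ii)): if a non-empty set `N ⊆ A` of configurations is down-closed inside `A`
and every member of `N` contains every vertex, then there are no vertices. [this work] -/
theorem verts_eq_empty_of_downClosed {A : Set (Set ι)} (hA : IsUpperSet A) {N : Set (Set ι)} (hNA : N ⊆ A) (hNne : N.Nonempty)
    (hdown : ∀ χ ∈ N, ∀ χ' ⊆ χ, χ' ∈ A → χ' ∈ N) (hV : ∀ χ ∈ N, ↑(verts A) ⊆ χ) : verts A = ∅ := by
  obtain ⟨χ, hχ⟩ := hNne
  refine verts_eq_empty_of_pivotal hA (hNA hχ) (hV χ hχ) fun f hf hmem => ?_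
  have hin : χ \ {f} ∈ N := hdown χ hχ _ Set.sdiff_subset hmem
  exact ((hV _ hin) (mem_coe.2 hf)).2 rfl

end GluedFrames

end Summit.CriticalPhenomena.PercolationContinuityZ3.Theorems
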